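/-
Copyright (c) 2026 the pub-hodgecm-mathlib formalisation cell (harness21).  Prover seat hodgecm-mathlib-F0P3a-p04 (g19): road «S3-ram» (LEAD F0P3a-plan (g12); junction
pen F0P3a-p01 (g17), J-PACK v2-iso; owner F0P3a-p06 (g15)); 2026-09-02.
-/
import Literature.NumberTheory.Automorphic.UnitaryLatticeTreeRootGrandchildLabelsRamified    -- ★ p847534 (this seat); brings ★ O-LBL, ★ L, ★ J, ★ H, ★ F (`v_childFrame_conj_sub_lower_le`)
import HarnessLib

/-!
# The lattice graph of a hermitian space — THE SAME-LEVEL NEIGHBOUR CRITERION and THE TRACE OBSTRUCTION for a child at a tame-ramified place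
# (Bruhat–Tits 1972 §10; Tits 1979 §3.5; Kottwitz 1986 §3)

Topic `NumberTheory/Automorphic`; namespace `Literature.NumberTheory.Automorphic.UnitaryLatticeTree`.  THEOREMS ONLY (no definition, no instance, no notation, no named fact,
no `sorry`); kernel lane `--supports stmt-HodgeConjecture-24833`.  Cell `pub/hodgecm-mathlib` (D-0151), crux H413; road «S3-ram» (Literature seeding, count-neutral); the
(a2) JUNCTION of the type-(1) ramified row, second wave J-PACK v2-iso (AXIS rows).  Two generic child-frame facts in the currency of ★ FILES E–K (`M = κ⁻¹(γ−1)κ` of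
level `ϖ^d`, neighbour `Λ′ = latt(κ·g(a,b))` through the line `x̄ = κe₀`, `g(a,b) = !![a∕ϖ,0,0; 0,1,0; b,0,ϖ]`, `|a| = 1`, `|b| ≤ 1`):
* §1 **`map_sub_one_childLatt_le_scaleLattice_iff_lower`** — `(γ−1)·Λ′ ⊆ ϖ^d·Λ′ ↔ |M₁₀| ≤ |ϖ|^{d+1} ∧ |M₂₁| ≤ |ϖ|^{d+1} ∧ |a·M₂₀ + ϖb·(M₂₂ − M₀₀)| ≤ |ϖ|^{d+2}`:
  the neighbour is AT LEAST AS DEEP as the vertex iff the three lower entries of `g⁻¹Mg ≡ L` (★ F `v_childFrame_conj_sub_lower_le`) pass — the `iff` whose `⇒` half is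
  ★ J `v_apply_le_succ_of_map_sub_one_childLatt_le`; the AXIS of an isoceles literal is where it holds (★-to-be `UnitaryLatticeTreeRootGrandchildLabelsIsocelesRamified`).
* §2 **`not_map_toLin'_latt_le_scaleLattice_of_v_trace`** — `|tr Y| = |ϖ|^d ⇒ ¬ Y·latt G ⊆ ϖ^{d+1}·latt G` for every invertible `G` (`tr(G⁻¹YG) = tr Y`): the level of a
  lattice under `γ − 1` never exceeds the order of `tr(γ − 1)` — at an axis vertex the level is EXACTLY `d₀`.

HONEST LABEL: HC_CM is proved only modulo the 2 remaining named inputs (hLiu418 24832, h413 24833) until rung 0 closes; nothing printed is asserted here (elementary algebra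
over a valuation ring); «S3-ram» has no books consequence.

## References
* [BruhatTits1972] F. Bruhat, J. Tits, *Groupes réductifs sur un corps local I*, Publ. Math. IHÉS 41 (1972), §10 (lattice models; vertex stabilisers and their filtrations).
* [Tits1979] J. Tits, *Reductive groups over local fields*, PSPM 33.1 (1979), §3.5 (congruence filtration; reduction mod `𝔭`).
* [Kottwitz1986] R. E. Kottwitz, *Base change for unit elements of Hecke algebras*, Compositio Math. 60 (1986), §3 (levels of fixed lattices; shell recursion).
* [Serre1980Trees] J.-P. Serre, *Trees* (1980), Ch. II §1.1–1.2 (lattices, neighbours, levels).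
-/

set_option autoImplicit false

noncomputable section

open scoped Valued WithZero Matrix MatrixGroups

namespace Literature.NumberTheory.Automorphic.UnitaryLatticeTree

open Literature.NumberTheory.Automorphic Literature.NumberTheory.Automorphic.HermitianLattice

variable {K : Type*} [Field K] [Valued K ℤᵐ⁰] {σ : K →+* K} {ϖ : K}

/-! ## §1 The same-level neighbour criterion -/

/-- **THE SAME-LEVEL NEIGHBOUR CRITERION** (the `iff` behind ★ J `v_apply_le_succ_of_map_sub_one_childLatt_le`): for `M = κ⁻¹(γ−1)κ` of level `ϖ^d` and the neighbour
`Λ′ = latt(κ·g(a,b))` through `x̄ = κe₀` (`|a| = 1`, `|b| ≤ 1`): **`(γ−1)·Λ′ ⊆ ϖ^d·Λ′ ↔ |M₁₀| ≤ |ϖ|^{d+1} ∧ |M₂₁| ≤ |ϖ|^{d+1} ∧ |a·M₂₀ + ϖb·(M₂₂ − M₀₀)| ≤ |ϖ|^{d+2}`**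
(★ F `v_childFrame_conj_sub_lower_le`: `g⁻¹Mg ≡ L` with `L₁₀ = (a∕ϖ)M₁₀`, `L₂₀ = (a∕ϖ²)M₂₀ + (b∕ϖ)(M₂₂ − M₀₀)`, `L₂₁ = ϖ⁻¹M₂₁`). [cite: Kottwitz1986, §3] [cite: Tits1979, §3.5] -/
theorem map_sub_one_childLatt_le_scaleLattice_iff_lower (hϖ : Valued.v ϖ = WithZero.exp (-1 : ℤ)) (κ γ : GL (Fin 3) K) {a b : K} (ha : Valued.v a = 1) (hb : Valued.v b ≤ 1)
    {d : ℕ} (hM : ∀ i j, Valued.v (((((κ⁻¹ : GL (Fin 3) K)) : Matrix (Fin 3) (Fin 3) K) * ((γ : Matrix (Fin 3) (Fin 3) K) - 1) * (κ : Matrix (Fin 3) (Fin 3) K)) i j) ≤ Valued.v ϖ ^ d) :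
    (latt ((κ : Matrix (Fin 3) (Fin 3) K) * !![a / ϖ, 0, 0; 0, 1, 0; b, 0, ϖ])).map ((Matrix.toLin' ((γ : Matrix (Fin 3) (Fin 3) K) - 1)).restrictScalars 𝒪[K]) ≤
        scaleLattice (ϖ ^ d) (latt ((κ : Matrix (Fin 3) (Fin 3) K) * !![a / ϖ, 0, 0; 0, 1, 0; b, 0, ϖ])) ↔
      Valued.v (((((κ⁻¹ : GL (Fin 3) K)) : Matrix (Fin 3) (Fin 3) K) * ((γ : Matrix (Fin 3) (Fin 3) K) - 1) * (κ : Matrix (Fin 3) (Fin 3) K)) 1 0) ≤ Valued.v ϖ ^ (d + 1) ∧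
      Valued.v (((((κ⁻¹ : GL (Fin 3) K)) : Matrix (Fin 3) (Fin 3) K) * ((γ : Matrix (Fin 3) (Fin 3) K) - 1) * (κ : Matrix (Fin 3) (Fin 3) K)) 2 1) ≤ Valued.v ϖ ^ (d + 1) ∧
      Valued.v (a * ((((κ⁻¹ : GL (Fin 3) K)) : Matrix (Fin 3) (Fin 3) K) * ((γ : Matrix (Fin 3) (Fin 3) K) - 1) * (κ : Matrix (Fin 3) (Fin 3) K)) 2 0 +
        ϖ * b * (((((κ⁻¹ : GL (Fin 3) K)) : Matrix (Fin 3) (Fin 3) K) * ((γ : Matrix (Fin 3) (Fin 3) K) - 1) * (κ : Matrix (Fin 3) (Fin 3) K)) 2 2 -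
          ((((κ⁻¹ : GL (Fin 3) K)) : Matrix (Fin 3) (Fin 3) K) * ((γ : Matrix (Fin 3) (Fin 3) K) - 1) * (κ : Matrix (Fin 3) (Fin 3) K)) 0 0)) ≤ Valued.v ϖ ^ (d + 2) := by
  have hϖ0 : ϖ ≠ 0 := fun h0 => by rw [h0, map_zero] at hϖ; exact WithZero.coe_ne_zero hϖ.symm
  have hvϖ0 : Valued.v ϖ ≠ 0 := (Valuation.ne_zero_iff _).2 hϖ0
  have ha0 : a ≠ 0 := fun h0 => by rw [h0, map_zero] at ha; exact zero_ne_one ha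
  have hpos : ∀ n : ℕ, 0 < Valued.v ϖ ^ n := fun n => pow_pos (zero_lt_iff.2 hvϖ0) n
  set M : Matrix (Fin 3) (Fin 3) K := (((κ⁻¹ : GL (Fin 3) K)) : Matrix (Fin 3) (Fin 3) K) * ((γ : Matrix (Fin 3) (Fin 3) K) - 1) * (κ : Matrix (Fin 3) (Fin 3) K)
    with hMdef
  rw [map_toLin'_latt_le_scaleLattice_iff (pow_ne_zero _ hϖ0) _ (isUnit_det_coe_mul_childFrame κ hϖ0 ha0 b), inv_coe_mul_childFrame_conj_eq κ hϖ0 ha0, map_pow]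
  set C : Matrix (Fin 3) (Fin 3) K := (!![ϖ / a, 0, 0; 0, 1, 0; -b / a, 0, ϖ⁻¹] : Matrix (Fin 3) (Fin 3) K) * M * !![a / ϖ, 0, 0; 0, 1, 0; b, 0, ϖ] with hCdef
  set L : Matrix (Fin 3) (Fin 3) K := !![0, 0, 0; (a / ϖ) * M 1 0, 0, 0; (a / ϖ ^ 2) * M 2 0 + (b / ϖ) * (M 2 2 - M 0 0), ϖ⁻¹ * M 2 1, 0] with hLdef
  have hCL : ∀ i j, Valued.v ((C - L) i j) ≤ Valued.v ϖ ^ d := v_childFrame_conj_sub_lower_le hϖ ha hb hM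
  -- `C ≡ L` entrywise, so the two systems of bounds are equivalent
  have key : ∀ i j, Valued.v (C i j) ≤ Valued.v ϖ ^ d ↔ Valued.v (L i j) ≤ Valued.v ϖ ^ d := fun i j => by
    constructor
    · intro h
      have e : L i j = C i j - (C - L) i j := by rw [Matrix.sub_apply]; ring
      rw [e]; exact (Valuation.map_sub _ _ _).trans (max_le h (hCL i j))
    · intro h
      have e : C i j = (C - L) i j + L i j := by rw [Matrix.sub_apply]; ring
      rw [e]; exact (Valuation.map_add _ _ _).trans (max_le (hCL i j) h)
  -- the three non-trivial entries of `L`, rescaled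
  have hL10 : L 1 0 = (a * M 1 0) / ϖ := by simp [hLdef]; ring
  have hL21 : L 2 1 = M 2 1 / ϖ := by simp [hLdef]; ring
  have hL20 : L 2 0 = (a * M 2 0 + ϖ * b * (M 2 2 - M 0 0)) / ϖ ^ 2 := by simp [hLdef]; field_simp
  have resc1 : ∀ x : K, Valued.v (x / ϖ) ≤ Valued.v ϖ ^ d ↔ Valued.v x ≤ Valued.v ϖ ^ (d + 1) := fun x => by
    rw [map_div₀, div_le_iff₀ (zero_lt_iff.2 hvϖ0), pow_succ]
  have resc2 : ∀ x : K, Valued.v (x / ϖ ^ 2) ≤ Valued.v ϖ ^ d ↔ Valued.v x ≤ Valued.v ϖ ^ (d + 2) := fun x => by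
    rw [map_div₀, map_pow, div_le_iff₀ (hpos 2), pow_add]
  constructor
  · intro h
    have h10 := (key 1 0).1 (h 1 0)
    have h21 := (key 2 1).1 (h 2 1)
    have h20 := (key 2 0).1 (h 2 0)
    rw [hL10, resc1, map_mul, ha, one_mul] at h10
    rw [hL21, resc1] at h21
    rw [hL20, resc2] at h20
    exact ⟨h10, h21, h20⟩
  · rintro ⟨h10, h21, h20⟩ i j
    apply (key i j).2
    have hz : ∀ i j : Fin 3, ¬ (i = 1 ∧ j = 0) → ¬ (i = 2 ∧ j = 0) → ¬ (i = 2 ∧ j = 1) → L i j = 0 := by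
      rw [hLdef]
      clear key hCL hL10 hL21 hL20 resc1 resc2 hM hCdef hLdef h10 h21 h20
      intro i j h1 h2 h3
      fin_cases i <;> fin_cases j <;> simp at h1 h2 h3 ⊢
    by_cases h1 : i = 1 ∧ j = 0
    · obtain ⟨rfl, rfl⟩ := h1
      rw [hL10, resc1, map_mul, ha, one_mul]; exact h10
    by_cases h2 : i = 2 ∧ j = 0
    · obtain ⟨rfl, rfl⟩ := h2
      rw [hL20, resc2]; exact h20
    by_cases h3 : i = 2 ∧ j = 1
    · obtain ⟨rfl, rfl⟩ := h3
      rw [hL21, resc1]; exact h21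
    rw [hz i j h1 h2 h3, map_zero]; exact zero_le

/-! ## §2 The trace obstruction -/

/-- **THE TRACE OBSTRUCTION**: if `|tr Y| = |ϖ|^d` then `Y·latt G ⊄ ϖ^{d+1}·latt G` for every invertible `G` (`tr(G⁻¹YG) = tr Y` and an entrywise bound `≤ |ϖ|^{d+1}` bounds
the trace). [cite: Serre1980Trees, II.1.1] [cite: Kottwitz1986, §3] -/
theorem not_map_toLin'_latt_le_scaleLattice_of_v_trace (hϖ : Valued.v ϖ = WithZero.exp (-1 : ℤ)) {n : ℕ} {G : Matrix (Fin n) (Fin n) K} (hG : IsUnit G.det)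
    (Y : Matrix (Fin n) (Fin n) K) {d : ℕ} (htr : Valued.v Y.trace = Valued.v ϖ ^ d) :
    ¬ (latt G).map ((Matrix.toLin' Y).restrictScalars 𝒪[K]) ≤ scaleLattice (ϖ ^ (d + 1)) (latt G) := by
  have hϖ0 : ϖ ≠ 0 := fun h0 => by rw [h0, map_zero] at hϖ; exact WithZero.coe_ne_zero hϖ.symm
  have hvϖ0 : Valued.v ϖ ≠ 0 := (Valuation.ne_zero_iff _).2 hϖ0
  have hϖlt : Valued.v ϖ < 1 := by rw [hϖ, ← WithZero.exp_zero]; exact WithZero.exp_lt_exp.2 (by norm_num)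
  rw [map_toLin'_latt_le_scaleLattice_iff (pow_ne_zero _ hϖ0) _ hG, map_pow]
  intro h
  have htr' : (G⁻¹ * Y * G).trace = Y.trace := by rw [Matrix.trace_mul_cycle, Matrix.mul_nonsing_inv _ hG, Matrix.one_mul]
  have hle : Valued.v ((G⁻¹ * Y * G).trace) ≤ Valued.v ϖ ^ (d + 1) := Valuation.map_sum_le _ fun i _ => by rw [Matrix.diag_apply]; exact h i i
  have hlt : Valued.v ϖ ^ (d + 1) < Valued.v ϖ ^ d := by
    rw [pow_succ]; exact mul_lt_of_lt_one_right (pow_pos (zero_lt_iff.2 hvϖ0) _) hϖlt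
  rw [htr', htr] at hle
  exact (lt_irrefl _) (hle.trans_lt hlt)

end Literature.NumberTheory.Automorphic.UnitaryLatticeTree

end
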